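import Mathlib.Data.Fintype.BigOperators
import Mathlib.Data.Fintype.Pi
import Mathlib.Data.Fintype.Prod
import Mathlib.Algebra.BigOperators.Ring.Finset
import Mathlib.Data.ZMod.Basic
import Literature.Computability.MetaComplexity.FpLinearSystems
import Literature.Computability.MetaComplexity.ScopeExpansion
import HarnessLib

/-!
# Random sparse matrices are boundary expanders: the counting core (route ExpanderLinearGenerators)

Helper file for item `stmt-PneNP-11444`
(`Summit.PneNP.PneNP.Theses.ExpanderLinearGenerators.LinearGeneratorModPFregeHard`) — and equally
for the sibling rungs `LinearGeneratorDepthFregeHard` (stmt-PneNP-11443) and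
`ExpansionForcesDepthFregeSize` (stmt-PneNP-11442), which share its hypotheses: an `ℓ`-sparse
system of linear equations over `𝔽₂` whose row supports form an `(r, 3/4·ℓ)`-boundary expander
and which is unsolvable. This file is the combinatorial half of the kernel-checked proof that such
systems EXIST at every expansion scale (so the rungs are not vacuous); the analytic half and the
assembled existence theorems are in `…ModPFregeHardInstances.lean`.

The construction is the random one of Krajíček's Theorem 13.3.1 (= Alekhnovich–Ben-Sasson–
Razborov–Wigderson 2004, Thm. 5.1), derandomised into a pigeonhole count. A matrix with `m` rows
of locality `ℓ = 8k` is coded by its PICKS `f : Fin m × Fin (8k) → Fin n` (row `i` has support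
`{f (i, 0), …, f (i, 8k-1)}`, of size `≤ 8k`). If some nonempty row set `F` of size `s ≤ R`
covers at most `7k·s` columns, then all picks of the rows of `F` lie in a column set `T` of
size exactly `7ks` (`7kR ≤ n`), i.e. `f` lies in the box `{f | ∀ i ∈ F, ∀ t, f (i, t) ∈ T}` of
`(7ks)^{8ks} · n^{8k(m-s)}` functions (`card_box`). Hence if
`Σ_{s=1}^{R} C(m,s) · C(n,7ks) · ((7ks)^s n^{m-s})^{8k} < n^{8km}` some `f` avoids every box
(`exists_coverExpanding_picks`), and its support family covers `> 7k|F|` columns for all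
`1 ≤ |F| ≤ R` — cover expansion `7k = (8k + 6k)/2`, which gives `(R, 6k) = (R, 3/4·ℓ)`-boundary
expansion (`IsCoverExpander.isBoundaryExpander`). Finally a system with `n + 1` rows in `n`
unknowns has an unsolvable right-hand side (`exists_rhs_not_systemSat`, `|𝔽₂ⁿ| < |𝔽₂ⁿ⁺¹|`).

References: J. Krajíček, *Proof Complexity* (CUP 2019), §13.3, Thm. 13.3.1
[KrajicekProofComplexity2019]; M. Alekhnovich, E. Ben-Sasson, A. A. Razborov, A. Wigderson,
*Pseudorandom generators in propositional proof complexity*, SIAM J. Comput. 34 (2004), Thm. 5.1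
[AlekhnovichEtAl2004].
-/

namespace Summit.PneNP.PneNP.Theorems

set_option linter.dupNamespace false -- `Summit.PneNP.PneNP.…`: summit = sub-problem (D-0017)

namespace RandomExpander

open Finset Literature.Computability.MetaComplexity

/-! ### Boxes of pick functions and their size -/

/-- **Size of a box.** The functions `Fin m × Fin ℓ → Fin n` sending every pick of the rows in
`F` into `T` number `(|T|^{|F|} · n^{m-|F|})^ℓ`. [folklore] -/
theorem card_box {m ℓ n : ℕ} (F : Finset (Fin m)) (T : Finset (Fin n)) :
    (Fintype.piFinset fun x : Fin m × Fin ℓ => if x.1 ∈ F then T else Finset.univ).card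
      = (T.card ^ F.card * n ^ (m - F.card)) ^ ℓ := by
  rw [Fintype.card_piFinset]
  have h1 : ∀ x : Fin m × Fin ℓ,
      (if x.1 ∈ F then T else (Finset.univ : Finset (Fin n))).card = if x.1 ∈ F then T.card else n :=
    fun x => by split_ifs <;> simp
  simp_rw [h1]
  rw [Finset.prod_ite, Finset.prod_const, Finset.prod_const]
  have hF : (Finset.univ.filter fun x : Fin m × Fin ℓ => x.1 ∈ F) = F ×ˢ Finset.univ := by
    ext ⟨i, t⟩; simp
  have hFc : (Finset.univ.filter fun x : Fin m × Fin ℓ => ¬ x.1 ∈ F) = Fᶜ ×ˢ Finset.univ := by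
    ext ⟨i, t⟩; simp
  rw [hF, hFc, Finset.card_product, Finset.card_product, Finset.card_compl, Finset.card_univ,
    Fintype.card_fin, Fintype.card_fin, mul_pow, ← pow_mul, ← pow_mul]

/-- A pick function whose `F`-rows pick inside `T` lies in the box of `(F, T)`. [folklore] -/
theorem mem_box {m ℓ n : ℕ} {F : Finset (Fin m)} {T : Finset (Fin n)} {f : Fin m × Fin ℓ → Fin n}
    (h : ∀ i ∈ F, ∀ t, f (i, t) ∈ T) :
    f ∈ Fintype.piFinset fun x : Fin m × Fin ℓ => if x.1 ∈ F then T else Finset.univ := by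
  rw [Fintype.mem_piFinset]
  rintro ⟨i, t⟩
  dsimp only
  split_ifs with hi
  · exact h i hi t
  · exact Finset.mem_univ _

/-- **Union bound.** The pick functions for which some row set of a size `s ∈ [1, R]` picks inside
a column set of size `7ks` number at most `Σ_{s=1}^{R} C(m,s) · C(n,7ks) · ((7ks)^s n^{m-s})^{8k}`.
[cite: KrajicekProofComplexity2019, Theorem 13.3.1 (proof)] -/
theorem card_bad_le (k m n R : ℕ) :
    ((Finset.Icc 1 R).biUnion fun s => (Finset.powersetCard s (Finset.univ : Finset (Fin m))).biUnion
      fun F => (Finset.powersetCard (7 * k * s) (Finset.univ : Finset (Fin n))).biUnion fun T =>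
        Fintype.piFinset fun x : Fin m × Fin (8 * k) => if x.1 ∈ F then T else Finset.univ).card
    ≤ ∑ s ∈ Finset.Icc 1 R,
        m.choose s * (n.choose (7 * k * s) * ((7 * k * s) ^ s * n ^ (m - s)) ^ (8 * k)) := by
  refine Finset.card_biUnion_le.trans (Finset.sum_le_sum fun s _ => ?_)
  refine Finset.card_biUnion_le.trans ?_
  have hF : ∀ F ∈ Finset.powersetCard s (Finset.univ : Finset (Fin m)),
      ((Finset.powersetCard (7 * k * s) (Finset.univ : Finset (Fin n))).biUnion fun T =>
        Fintype.piFinset fun x : Fin m × Fin (8 * k) => if x.1 ∈ F then T else Finset.univ).card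
      ≤ n.choose (7 * k * s) * ((7 * k * s) ^ s * n ^ (m - s)) ^ (8 * k) := by
    intro F hF
    have hFs : F.card = s := (Finset.mem_powersetCard.1 hF).2
    refine Finset.card_biUnion_le.trans ?_
    have hT : ∀ T ∈ Finset.powersetCard (7 * k * s) (Finset.univ : Finset (Fin n)),
        (Fintype.piFinset fun x : Fin m × Fin (8 * k) => if x.1 ∈ F then T else Finset.univ).card
          = ((7 * k * s) ^ s * n ^ (m - s)) ^ (8 * k) := by
      intro T hT
      rw [card_box, (Finset.mem_powersetCard.1 hT).2, hFs]
    rw [Finset.sum_congr rfl hT, Finset.sum_const, Finset.card_powersetCard, Finset.card_univ,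
      Fintype.card_fin, smul_eq_mul]
  refine (Finset.sum_le_sum hF).trans ?_
  rw [Finset.sum_const, Finset.card_powersetCard, Finset.card_univ, Fintype.card_fin, smul_eq_mul]

/-- **Cover-expanding pick functions exist** when the union bound beats the total count: if
`7kR ≤ n` and `Σ_{s=1}^{R} C(m,s) C(n,7ks) ((7ks)^s n^{m-s})^{8k} < n^{m·8k}`, some
`f : Fin m × Fin (8k) → Fin n` has the property that every nonempty set `F` of at most `R` rows
covers more than `7k·|F|` columns. [cite: KrajicekProofComplexity2019, Theorem 13.3.1 (proof)] -/
theorem exists_coverExpanding_picks (k m n R : ℕ) (hR : 7 * k * R ≤ n)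
    (hlt : ∑ s ∈ Finset.Icc 1 R,
        m.choose s * (n.choose (7 * k * s) * ((7 * k * s) ^ s * n ^ (m - s)) ^ (8 * k))
      < n ^ (m * (8 * k))) :
    ∃ f : Fin m × Fin (8 * k) → Fin n, ∀ F : Finset (Fin m), F.Nonempty → F.card ≤ R →
      7 * k * F.card < (F.biUnion fun i => Finset.univ.image fun t => f (i, t)).card := by
  set Bad := (Finset.Icc 1 R).biUnion fun s =>
    (Finset.powersetCard s (Finset.univ : Finset (Fin m))).biUnion fun F =>
      (Finset.powersetCard (7 * k * s) (Finset.univ : Finset (Fin n))).biUnion fun T =>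
        Fintype.piFinset fun x : Fin m × Fin (8 * k) => if x.1 ∈ F then T else Finset.univ
    with hBad
  have hcard : Bad.card < (Finset.univ : Finset (Fin m × Fin (8 * k) → Fin n)).card := by
    rw [Finset.card_univ, Fintype.card_fun, Fintype.card_prod, Fintype.card_fin, Fintype.card_fin,
      Fintype.card_fin]
    exact (card_bad_le k m n R).trans_lt hlt
  obtain ⟨f, -, hf⟩ := Finset.exists_mem_notMem_of_card_lt_card hcard
  refine ⟨f, fun F hF hFR => ?_⟩
  by_contra hle
  push Not at hle
  apply hf
  have hs : F.card ∈ Finset.Icc 1 R := Finset.mem_Icc.2 ⟨Finset.card_pos.2 hF, hFR⟩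
  have h7 : 7 * k * F.card ≤ Fintype.card (Fin n) := by
    rw [Fintype.card_fin]
    exact (Nat.mul_le_mul_left _ hFR).trans hR
  obtain ⟨T, hT, hTc⟩ := Finset.exists_superset_card_eq hle h7
  rw [hBad]
  simp only [Finset.mem_biUnion, Finset.mem_powersetCard]
  exact ⟨F.card, hs, F, ⟨Finset.subset_univ _, rfl⟩, T, ⟨Finset.subset_univ _, hTc⟩,
    mem_box fun i hi t => hT (Finset.mem_biUnion.2 ⟨i, hi, Finset.mem_image_of_mem _ (Finset.mem_univ _)⟩)⟩

/-! ### From cover expansion of the picks to a sparse boundary-expanding unsolvable system -/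

/-- **An over-determined system has an unsolvable right-hand side**: for `n < m` and any
coefficient rows `A`, some `b ∈ 𝔽₂^m` lies outside the image of `z ↦ A z` (`2^n < 2^m`), so the
system `(A, b)` has no solution. [folklore] -/
theorem exists_rhs_not_systemSat {m n : ℕ} (hmn : n < m) (A : Fin m → Fin n → ZMod 2) :
    ∃ b : Fin m → ZMod 2, ¬ SystemSat (fun i => (A i, b i)) Finset.univ := by
  have hns : ¬ Function.Surjective (fun (z : Fin n → ZMod 2) (i : Fin m) => ∑ j, A i j * z j) := by
    intro hsurj
    have := Fintype.card_le_of_surjective _ hsurj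
    simp only [Fintype.card_fun, ZMod.card, Fintype.card_fin] at this
    exact absurd this (not_le.2 (Nat.pow_lt_pow_right (by norm_num) hmn))
  obtain ⟨b, hb⟩ := not_forall.1 hns
  refine ⟨b, fun ⟨z, hz⟩ => hb ⟨z, funext fun i => ?_⟩⟩
  exact hz i (Finset.mem_univ _)

/-- The support of the indicator row of a column set is that set. [folklore] -/
theorem supp_indicator {n : ℕ} (S : Finset (Fin n)) (b : ZMod 2) :
    LinEqMod.supp ((fun j => if j ∈ S then (1 : ZMod 2) else 0, b) : LinEqMod 2 n) = S := by
  ext j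
  simp [LinEqMod.supp]

/-- Boundary expansion at the integer radius `⌊r⌋₊` is boundary expansion at radius `r`
(row sets have integer size). [folklore] -/
theorem isBoundaryExpander_of_floor {ι : Type*} [DecidableEq ι] (S : ι → Finset ℕ) {r c : ℝ}
    (h : IsBoundaryExpander S (⌊r⌋₊ : ℝ) c) : IsBoundaryExpander S r c := by
  intro F hF
  rcases lt_or_ge r 0 with hr | _
  · exact absurd (hF.trans_lt hr) (not_lt.2 (Nat.cast_nonneg _))
  · exact h F (by exact_mod_cast Nat.le_floor hF)

/-- **From cover-expanding picks to the system.** Given picks `f : Fin (n+1) × Fin (8k) → Fin n`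
such that every nonempty set of `≤ R` rows covers `> 7k` columns per row, the system over `𝔽₂`
whose row `i` is the indicator of `{f (i, t)}_t` (with an unsolvable right-hand side, which
exists as there are `n + 1` rows) is `8k`-sparse, an `(R, 3/4 · 8k)`-boundary expander, and
unsolvable. [cite: KrajicekProofComplexity2019, Theorem 13.3.1] -/
theorem exists_system_of_picks {k n R : ℕ} (f : Fin (n + 1) × Fin (8 * k) → Fin n)
    (hf : ∀ F : Finset (Fin (n + 1)), F.Nonempty → F.card ≤ R →
      7 * k * F.card < (F.biUnion fun i => Finset.univ.image fun t => f (i, t)).card) :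
    ∃ E : Fin (n + 1) → LinEqMod 2 n, (∀ i, (E i).supp.card ≤ 8 * k) ∧
      IsBoundaryExpander (fun i => (E i).supp.map Fin.valEmbedding) (R : ℝ)
        (3 / 4 * ((8 * k : ℕ) : ℝ)) ∧
      ¬ SystemSat E Finset.univ := by
  obtain ⟨b, hb⟩ := exists_rhs_not_systemSat (Nat.lt_succ_self n)
    (fun i j => if j ∈ (Finset.univ.image fun t => f (i, t)) then (1 : ZMod 2) else 0)
  refine ⟨fun i => (fun j => if j ∈ (Finset.univ.image fun t => f (i, t)) then (1 : ZMod 2) else 0,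
    b i), fun i => ?_, ?_, hb⟩
  · rw [supp_indicator]
    exact Finset.card_image_le.trans (by simp)
  · have hS : ∀ i : Fin (n + 1), (LinEqMod.supp ((fun j => if j ∈ (Finset.univ.image fun t =>
        f (i, t)) then (1 : ZMod 2) else 0, b i) : LinEqMod 2 n)).map Fin.valEmbedding
        = (Finset.univ.image fun t => f (i, t)).image (fun j : Fin n => (j : ℕ)) := by
      intro i
      rw [supp_indicator, Finset.map_eq_image]
      rfl
    simp_rw [hS]
    have hrate : (3 : ℝ) / 4 * ((8 * k : ℕ) : ℝ) = 6 * k := by push_cast; ring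
    rw [hrate]
    refine IsCoverExpander.isBoundaryExpander (k := 8 * k)
      (fun i => Finset.card_image_le.trans (Finset.card_image_le.trans (by simp))) ?_
    intro F hF
    have hrate' : (((8 * k : ℕ) : ℝ) + 6 * k) / 2 = 7 * k := by push_cast; ring
    rw [hrate']
    rcases F.eq_empty_or_nonempty with rfl | hne
    · simp
    · have hFR : F.card ≤ R := by exact_mod_cast hF
      have hlt := hf F hne hFR
      have hcov : (cover (fun i => (Finset.univ.image fun t => f (i, t)).image
          (fun j : Fin n => (j : ℕ))) F).card
          = (F.biUnion fun i => Finset.univ.image fun t => f (i, t)).card := by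
        rw [cover, ← Finset.biUnion_image, Finset.card_image_of_injective _ Fin.val_injective]
      rw [hcov]
      exact_mod_cast hlt.le

end RandomExpander

end Summit.PneNP.PneNP.Theorems
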